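import Literature.NumberTheory.Rogawski1990.FinExplicitTransferFactorDockConstancy       -- ★ A-p17: `isLocalNormPair_of_val_eq_conj`; brings ★ `finKappaAt_eq_ite_of_eigenvector`, eventual constancy, non-degeneracy
import Literature.NumberTheory.Rogawski1990.FinExplicitTransferFactorConjRight           -- ★ `finExplicitDelta_conj_right`, `isUnit_localRing_of_ne_zero_of_subsingleton`
import Literature.NumberTheory.Rogawski1990.FinExplicitTransferFactorCentral             -- ★ `finHeckeValue_mul`
import Literature.NumberTheory.Rogawski1990.FinExplicitTransferFactorLocallyConstant     -- ★ `continuous_finGammaTwo`, `continuous_fst_localMatrix`, `continuousAt_finHeckeValue`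
import HarnessLib

/-!
# The explicit-factor split `Δ‴_v(↑t, θ(out ⟦τ t⟧)) = E · μ_w(γ₁ − γ₃)⁻¹ · D_H(τ t)` along the docked torus (binder `hfac` of the torus unstable junction)

Topic `NumberTheory/Rogawski1990`; namespace `Literature.NumberTheory.Rogawski1990`.  THEOREMS ONLY (no definition, no instance, no notation, no named
fact, no `sorry`).  B-p08 (g27), brick (J2b) of LEAD word T8-122 for the line «N6nsGerm» (`stub_N6nsS2`).
At a non-split finite place `v` let `ε_H = (A, a) ∈ H_v` be `H`-regular and `G`-singular with eigenframe `A·P = P·diag(a, b)` (`a ≠ b`), `C = Z_H(ε_H)` its torus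
(`t.1·P = P·diag(α_t, β_t)`, `u(t) = γ_t`), `τ t = (P·diag(α_t, γ_t)·P⁻¹, β_t)` the transport (★ `exists_torusTransport_frame`, A-p19) and `θ h = y·ι_v(h)·y⁻¹` a dock
into `Z_{G′_v}(ε)`.  On the matched pair `(↑t, θ(τ t))`, `Δ‴_v = τ_v·D_{G∕H,v}·κ_v` (★ `finExplicitDelta_of_isLocalNormPair`) with, in the frame,
`τ_v(↑t) = μ(γ)·μ(α − γ)⁻¹·μ((γ − β)·det t.1⁻¹)⁻¹`, `D_{G∕H,v}(↑t) = √Π‖α − γ‖ · √Π‖γ − β‖`, and `κ_v(↑t, θ(τ t))` READ ON THE FIXED VECTOR `y·(P e₂ ⊕ 0)` (the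
`γ_t`-eigenline of `(τ t).1` is the fixed column `P e₂`); so `Δ‴_v(↑t, θ(out ⟦τ t⟧)) = E₀ · [μ(α_t − γ_t)⁻¹ · √Π‖α_t − γ_t‖]` near the base point with `E₀` CONSTANT —
the bracket is the rank-one weight `Δ_{H∕C}(τ t) = μ_w(γ₁ − γ₃)⁻¹·D_H` of ★ `RankOneUnstableTransferNonsplit` in the frame `P` (`γ₁(τ t) = α_t`, `γ₃(τ t) = γ_t`):
the binder `hfac` of ★ `exists_nhds_finsum_delta_dock_eq_locallyConstant_of_torusTransfer` (B-p08, p842095).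
[cite: Rogawski1990, §4.9 p. 55; §8.2 Prop. 8.2.1 (c) pp. 113–115; §4.3 (4.3.2) p. 43] [cite: LanglandsShelstad1987, §1] [cite: LabesseLanglands1979, §2]
-/
noncomputable section

open Set Filter Topology Polynomial
open scoped Matrix

namespace Literature.NumberTheory.Rogawski1990

open Literature.NumberTheory.Automorphic Literature.NumberTheory.Automorphic.UnitaryGroup Literature.NumberTheory.GaloisRepresentations
open _root_.NumberField _root_.IsDedekindDomain _root_.Matrix

/-! ## §1 Frame algebra for `ι = endoGL` (any commutative ring) -/

section Frame

variable {S : Type*} [CommRing S]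

/-- In the frame `ι(P, 1)`, an element `ι(g, u)` with `g·P = P·diag(a, b)` is the diagonal `diag(a, u, b)`. [cite: Rogawski1990, §4.8 Case (a) p. 53] -/
theorem val_endoGL_frame_conj (P g : GL (Fin 2) S) (u : GL (Fin 1) S) {a b : S}
    (hg : (g.val : Matrix (Fin 2) (Fin 2) S) * P.val = P.val * diagonal ![a, b]) :
    ((endoGL (P, (1 : GL (Fin 1) S)))⁻¹ * endoGL (g, u) * endoGL (P, (1 : GL (Fin 1) S)) : GL (Fin 3) S).val =
      !![a, 0, 0; 0, (u.val : Matrix (Fin 1) (Fin 1) S) 0 0, 0; 0, 0, b] := by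
  have hm : ((P⁻¹ * g * P : GL (Fin 2) S).val : Matrix (Fin 2) (Fin 2) S) = diagonal ![a, b] := by
    rw [Units.val_mul, Units.val_mul, Matrix.mul_assoc, hg, ← Matrix.mul_assoc, ← Units.val_mul, inv_mul_cancel, Units.val_one, Matrix.one_mul]
  rw [← map_inv, ← map_mul, ← map_mul, Prod.inv_mk, inv_one, Prod.mk_mul_mk, Prod.mk_mul_mk, one_mul, mul_one, coe_endoGL_eq]
  simp only [hm]
  ext i j
  fin_cases i <;> fin_cases j <;> simp

/-- `diag(a, c, b)` and `diag(a, b, c)` are conjugate in `GL₃(S)` (by the coordinate swap `e₂ ↔ e₃`). [cite: Rogawski1990, §4.8 Case (a) p. 53] -/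
private theorem isConj_of_val_eq_diag3 {X X' : GL (Fin 3) S} {a b c : S}
    (hX : X.val = !![a, 0, 0; 0, c, 0; 0, 0, b]) (hX' : X'.val = !![a, 0, 0; 0, b, 0; 0, 0, c]) : IsConj X X' := by
  have hW : !![(1 : S), 0, 0; 0, 0, 1; 0, 1, 0] * !![(1 : S), 0, 0; 0, 0, 1; 0, 1, 0] = 1 := by
    ext i j; fin_cases i <;> fin_cases j <;> simp [Matrix.mul_apply, Fin.sum_univ_three]
  refine isConj_iff.2 ⟨⟨_, _, hW, hW⟩, Units.ext ?_⟩
  rw [Units.val_mul, Units.val_mul, hX, hX']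
  show !![(1 : S), 0, 0; 0, 0, 1; 0, 1, 0] * !![a, 0, 0; 0, c, 0; 0, 0, b] * !![(1 : S), 0, 0; 0, 0, 1; 0, 1, 0] = _
  ext i j
  fin_cases i <;> fin_cases j <;> simp [Matrix.mul_apply, Fin.sum_univ_three]

/-- **`ι(P·diag(α, β)·P⁻¹, γ)` and `ι(P·diag(α, γ)·P⁻¹, β)` ARE CONJUGATE IN `GL₃`** — the torus transport `β ↔ γ` does not change the `GL₃`-class of the image.
[cite: Rogawski1990, §4.8 Case (a) p. 53; §8.2 p. 113] -/
theorem isConj_endoGL_of_frames (P g g' : GL (Fin 2) S) (u u' : GL (Fin 1) S) {a b c : S}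
    (hg : (g.val : Matrix (Fin 2) (Fin 2) S) * P.val = P.val * diagonal ![a, b]) (hu : (u.val : Matrix (Fin 1) (Fin 1) S) 0 0 = c)
    (hg' : (g'.val : Matrix (Fin 2) (Fin 2) S) * P.val = P.val * diagonal ![a, c]) (hu' : (u'.val : Matrix (Fin 1) (Fin 1) S) 0 0 = b) :
    IsConj (endoGL (g, u)) (endoGL (g', u')) := by
  have h1 : IsConj (endoGL (g, u)) ((endoGL (P, (1 : GL (Fin 1) S)))⁻¹ * endoGL (g, u) * endoGL (P, (1 : GL (Fin 1) S))) :=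
    isConj_iff.2 ⟨(endoGL (P, (1 : GL (Fin 1) S)))⁻¹, by rw [inv_inv]⟩
  have h3 : IsConj (endoGL (g', u')) ((endoGL (P, (1 : GL (Fin 1) S)))⁻¹ * endoGL (g', u') * endoGL (P, (1 : GL (Fin 1) S))) :=
    isConj_iff.2 ⟨(endoGL (P, (1 : GL (Fin 1) S)))⁻¹, by rw [inv_inv]⟩
  have h2 := isConj_of_val_eq_diag3 (hu ▸ val_endoGL_frame_conj P g u hg) (hu' ▸ val_endoGL_frame_conj P g' u' hg')
  exact (h1.trans h2).trans h3.symm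

/-- A matrix with `g·P = P·diag(a, b)` has the column `P e₂` as a `b`-eigenvector. [cite: Rogawski1990, §4.8 Case (a) p. 53] -/
theorem mulVec_col_one_of_frame {g P : Matrix (Fin 2) (Fin 2) S} {a b : S} (hg : g * P = P * diagonal ![a, b]) :
    g *ᵥ (fun i => P i 1) = b • fun i => P i 1 := by
  ext i
  have h := congrFun (congrFun hg i) 1
  simp only [Matrix.mul_apply, Fin.sum_univ_two, Matrix.diagonal] at h
  simp only [Matrix.mulVec, dotProduct, Fin.sum_univ_two, Pi.smul_apply, smul_eq_mul]
  rw [h]; simp; ring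

/-- **The `γ`-eigenvector of `ι(g′, u′)` for `g′·P = P·diag(α, γ)`** is the fixed vector `P e₂ ⊕ 0 = (P₀₁, 0, P₁₁)`. [cite: Rogawski1990, §4.8 Case (a) p. 53] -/
theorem endoGL_mulVec_frameVec (P g' : GL (Fin 2) S) (u' : GL (Fin 1) S) {a c : S}
    (hg' : (g'.val : Matrix (Fin 2) (Fin 2) S) * P.val = P.val * diagonal ![a, c]) :
    ((endoGL (g', u') : GL (Fin 3) S).val : Matrix (Fin 3) (Fin 3) S) *ᵥ ![P.val 0 1, 0, P.val 1 1] = c • ![P.val 0 1, 0, P.val 1 1] := by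
  have hcol := mulVec_col_one_of_frame hg'
  have h0 := congrFun hcol 0; have h1 := congrFun hcol 1
  simp only [Matrix.mulVec, dotProduct, Fin.sum_univ_two, Pi.smul_apply, smul_eq_mul] at h0 h1
  rw [coe_endoGL_eq]
  ext i
  fin_cases i <;> simp [Matrix.mulVec, dotProduct, Fin.sum_univ_three, h0, h1]

/-- The frame vector `(P₀₁, 0, P₁₁)` is non-zero (`P` is invertible; `S` non-trivial). [cite: Rogawski1990, §4.8 Case (a) p. 53] -/
theorem frameVec_ne_zero [Nontrivial S] (P : GL (Fin 2) S) : (![P.val 0 1, 0, P.val 1 1] : Fin 3 → S) ≠ 0 := by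
  intro h
  have h0 : P.val 0 1 = 0 := by simpa using congrFun h 0
  have h1 : P.val 1 1 = 0 := by simpa using congrFun h 2
  have hdet : IsUnit (P.val : Matrix (Fin 2) (Fin 2) S).det := (Matrix.isUnits_det_units P)
  rw [Matrix.det_fin_two, h0, h1, mul_zero, zero_mul, sub_zero] at hdet
  exact not_isUnit_zero hdet

end Frame

/-! ## §2 Matching and `κ_v` at the base class of the docked torus -/

section Dock

variable {L : Type} [Field L] [NumberField L] [IsCMField L] {H' : Matrix (Fin 3) (Fin 3) L} {v : HeightOneSpectrum (𝓞 ↥(maximalRealSubfield L))}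

omit [IsCMField L] in
/-- `E_v = ∏_{w∣v} L_w` is non-trivial (there is a place above `v`). [cite: CasselsFrohlichANT1967, Ch. II §10] -/
private theorem nontrivial_localRing'' : Nontrivial (LocalRing L v) := by
  obtain ⟨w⟩ := (inferInstance : Nonempty (PlacesOver L v))
  exact ⟨⟨0, 1, fun h => zero_ne_one (congrFun h w)⟩⟩

omit [IsCMField L] in
/-- The normalised absolute value of a completion `L_w` is constant near every non-zero point (`Valued.locally_const`).
[cite: CasselsFrohlichANT1967, Ch. II §10] -/
private theorem norm_eventually_eq_of_ne_zero'' (w : HeightOneSpectrum (𝓞 L)) {x : w.adicCompletion L} (hx : x ≠ 0) :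
    ∀ᶠ y in 𝓝 x, ‖y‖ = ‖x‖ := by
  have hv : (Valued.v x : WithZero (Multiplicative ℤ)) ≠ 0 := (Valuation.ne_zero_iff _).2 hx
  filter_upwards [Valued.locally_const hv] with y hy
  exact le_antisymm (by rw [Valued.toNormedField.norm_le_iff]; exact hy.le) (by rw [Valued.toNormedField.norm_le_iff]; exact hy.ge)

/-- **THE TRANSPORTED TORUS POINT MATCHES THE ORIGINAL ONE**: for `t = (P·diag(α, β)·P⁻¹, γ)` and `t′ = (P·diag(α, γ)·P⁻¹, β)` in `H_v` and `b ∈ G′_v` with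
`b = y·ι_v(t′)·y⁻¹`, the pair `ι_v(t) ↔ b` matches (`ι_v(t)`, `ι_v(t′)` are `GL₃`-conjugate: ★ `isConj_endoGL_of_frames`). [cite: Rogawski1990, §8.2 Prop. 8.2.1 (c) p. 113; §4.8 p. 53; §14.1 p. 232] -/
theorem isLocalNormPair_of_frames_of_val_eq_conj {t t' : ((cmDatum L 2 (Matrix.of fun i j : Fin 2 => if i.val + j.val + 1 = 2 then (1 : L) else 0)).Local v ×
      (cmDatum L 1 (Matrix.of fun i j : Fin 1 => if i.val + j.val + 1 = 1 then (1 : L) else 0)).Local v)} (P : GL (Fin 2) (LocalRing L v)) {α β : LocalRing L v}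
    (ht : (t.1.val.val : Matrix (Fin 2) (Fin 2) (LocalRing L v)) * P.val = P.val * diagonal ![α, β])
    (ht' : (t'.1.val.val : Matrix (Fin 2) (Fin 2) (LocalRing L v)) * P.val = P.val * diagonal ![α, finGammaTwo L v t])
    (ht'u : (t'.2.val.val : Matrix (Fin 1) (Fin 1) (LocalRing L v)) = β • (1 : Matrix (Fin 1) (Fin 1) (LocalRing L v)))
    {b : (cmDatum L 3 H').Local v} {y : GL (Fin 3) (LocalRing L v)}
    (hb : (b.val : GL (Fin 3) (LocalRing L v)) = y * ((endoEmbLocal L v t').val : GL (Fin 3) (LocalRing L v)) * y⁻¹) :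
    IsLocalNormPair L H' v t b := by
  have h1 : IsConj ((endoEmbLocal L v t).val : GL (Fin 3) (LocalRing L v)) ((endoEmbLocal L v t').val : GL (Fin 3) (LocalRing L v)) := by
    rw [coe_endoEmbLocal, coe_endoEmbLocal]
    exact isConj_endoGL_of_frames P _ _ _ _ ht rfl ht' (by rw [ht'u]; simp)
  exact h1.trans (isLocalNormPair_of_val_eq_conj hb)

/-- Along the dock `b = y·ι_v(t′)·y⁻¹` the vector `y·(P₀₁, 0, P₁₁)` is a `γ`-eigenvector of `b` (`γ = u(t)`), and it is non-zero. [cite: Rogawski1990, §4.8 p. 53; §4.3 p. 43] -/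
theorem mulVec_frameVec_of_val_eq_conj {t t' : ((cmDatum L 2 (Matrix.of fun i j : Fin 2 => if i.val + j.val + 1 = 2 then (1 : L) else 0)).Local v ×
      (cmDatum L 1 (Matrix.of fun i j : Fin 1 => if i.val + j.val + 1 = 1 then (1 : L) else 0)).Local v)} (P : GL (Fin 2) (LocalRing L v)) {α : LocalRing L v}
    (ht' : (t'.1.val.val : Matrix (Fin 2) (Fin 2) (LocalRing L v)) * P.val = P.val * diagonal ![α, finGammaTwo L v t])
    {b : (cmDatum L 3 H').Local v} {y : GL (Fin 3) (LocalRing L v)}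
    (hb : (b.val : GL (Fin 3) (LocalRing L v)) = y * ((endoEmbLocal L v t').val : GL (Fin 3) (LocalRing L v)) * y⁻¹) :
    (b.val.val : Matrix (Fin 3) (Fin 3) (LocalRing L v)) *ᵥ (y.val *ᵥ ![P.val 0 1, 0, P.val 1 1]) =
      finGammaTwo L v t • (y.val *ᵥ ![P.val 0 1, 0, P.val 1 1]) := by
  have hgm' : (b.val : GL (Fin 3) (LocalRing L v)) * y = y * ((endoEmbLocal L v t').val : GL (Fin 3) (LocalRing L v)) := by
    rw [hb, inv_mul_cancel_right]
  have hgm : (b.val.val : Matrix (Fin 3) (Fin 3) (LocalRing L v)) * y.val =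
      y.val * ((endoEmbLocal L v t').val.val : Matrix (Fin 3) (Fin 3) (LocalRing L v)) := by
    rw [← Units.val_mul, hgm', Units.val_mul]
  have hev : ((endoEmbLocal L v t').val.val : Matrix (Fin 3) (Fin 3) (LocalRing L v)) *ᵥ ![P.val 0 1, 0, P.val 1 1] =
      finGammaTwo L v t • ![P.val 0 1, 0, P.val 1 1] :=
    endoGL_mulVec_frameVec P _ _ ht'
  rw [Matrix.mulVec_mulVec, hgm, ← Matrix.mulVec_mulVec, hev, Matrix.mulVec_smul]

omit [IsCMField L] in
/-- The docked frame vector `y·(P₀₁, 0, P₁₁)` is non-zero. [cite: Rogawski1990, §4.8 p. 53] -/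
theorem mulVec_frameVec_ne_zero (P : GL (Fin 2) (LocalRing L v)) (y : GL (Fin 3) (LocalRing L v)) :
    y.val *ᵥ (![P.val 0 1, 0, P.val 1 1] : Fin 3 → LocalRing L v) ≠ 0 := by
  haveI := nontrivial_localRing'' (L := L) (v := v)
  intro h; apply frameVec_ne_zero P
  calc (![P.val 0 1, 0, P.val 1 1] : Fin 3 → LocalRing L v)
        = ((y⁻¹).val * y.val) *ᵥ ![P.val 0 1, 0, P.val 1 1] := by
          rw [← Units.val_mul, inv_mul_cancel, Units.val_one, Matrix.one_mulVec]
    _ = 0 := by rw [← Matrix.mulVec_mulVec, h, Matrix.mulVec_zero]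

open scoped Classical in
/-- **`κ_v` AT THE BASE CLASS OF THE DOCKED TORUS IS READ ON THE FIXED VECTOR `y·(P e₂ ⊕ 0)`** (non-split `v`): for `t = (P·diag(α, β)·P⁻¹, γ)` `G`-regular enough
(`χ_{t.1}(γ)` a unit), `t′ = (P·diag(α, γ)·P⁻¹, β)` and `b = y·ι_v(t′)·y⁻¹`, `κ_v(t, b) = +1` iff `⟨y p₀, y p₀⟩_{H′_v}` is a unit norm, `p₀ = (P₀₁, 0, P₁₁)` — independent of
`t`. [cite: Rogawski1990, §4.3 (4.3.2) p. 43; §3.5 Prop. 3.5.2 (c) p. 29; §8.2 p. 113] [cite: LanglandsShelstad1987, §1] -/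
theorem finKappaAt_eq_ite_of_frames_of_val_eq_conj (hv : Subsingleton (PlacesOver L v)) {t t' : ((cmDatum L 2 (Matrix.of fun i j : Fin 2 => if i.val + j.val + 1 = 2 then (1 : L) else 0)).Local v ×
      (cmDatum L 1 (Matrix.of fun i j : Fin 1 => if i.val + j.val + 1 = 1 then (1 : L) else 0)).Local v)} (P : GL (Fin 2) (LocalRing L v))
    {α β : LocalRing L v}
    (ht : (t.1.val.val : Matrix (Fin 2) (Fin 2) (LocalRing L v)) * P.val = P.val * diagonal ![α, β])
    (ht' : (t'.1.val.val : Matrix (Fin 2) (Fin 2) (LocalRing L v)) * P.val = P.val * diagonal ![α, finGammaTwo L v t])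
    (ht'u : (t'.2.val.val : Matrix (Fin 1) (Fin 1) (LocalRing L v)) = β • (1 : Matrix (Fin 1) (Fin 1) (LocalRing L v)))
    {b : (cmDatum L 3 H').Local v} {y : GL (Fin 3) (LocalRing L v)}
    (hb : (b.val : GL (Fin 3) (LocalRing L v)) = y * ((endoEmbLocal L v t').val : GL (Fin 3) (LocalRing L v)) * y⁻¹)
    (hu : IsUnit ((finCharpolyTwo L v t).eval (finGammaTwo L v t))) :
    finKappaAt L v H' t b =
      if ∃ z : LocalRing L v, IsUnit z ∧
          (∑ i : Fin 3, ∑ k : Fin 3, conjLocal L (IsCMField.complexConj L) v ((y.val *ᵥ ![P.val 0 1, 0, P.val 1 1]) i) *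
            ((adelicForm L 3 H').map (adeleToLocal L v)) i k * (y.val *ᵥ ![P.val 0 1, 0, P.val 1 1]) k) =
          z * conjLocal L (IsCMField.complexConj L) v z
      then 1 else -1 :=
  finKappaAt_eq_ite_of_eigenvector L v H' t b hv (isLocalNormPair_of_frames_of_val_eq_conj P ht ht' ht'u hb) hu
    (mulVec_frameVec_of_val_eq_conj P ht' hb) (mulVec_frameVec_ne_zero P y)

/-! ## §3 The explicit factors `τ_v`, `D_{G∕H,v}` of a torus point in its eigenframe -/

/-- `χ_{t.1} = (X − α)(X − β)` for `t.1·P = P·diag(α, β)`. [cite: Rogawski1990, §4.9 p. 55] -/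
theorem finCharpolyTwo_eq_of_frame {t : ((cmDatum L 2 (Matrix.of fun i j : Fin 2 => if i.val + j.val + 1 = 2 then (1 : L) else 0)).Local v ×
      (cmDatum L 1 (Matrix.of fun i j : Fin 1 => if i.val + j.val + 1 = 1 then (1 : L) else 0)).Local v)} (P : GL (Fin 2) (LocalRing L v)) {α β : LocalRing L v}
    (ht : (t.1.val.val : Matrix (Fin 2) (Fin 2) (LocalRing L v)) * P.val = P.val * diagonal ![α, β]) :
    finCharpolyTwo L v t = (X - C α) * (X - C β) := by
  have hconj : (t.1.val.val : Matrix (Fin 2) (Fin 2) (LocalRing L v)) = P.val * diagonal ![α, β] * (P⁻¹).val := by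
    calc (t.1.val.val : Matrix (Fin 2) (Fin 2) (LocalRing L v)) = (t.1.val.val : Matrix (Fin 2) (Fin 2) (LocalRing L v)) * (P.val * (P⁻¹).val) := by
          rw [← Units.val_mul, mul_inv_cancel, Units.val_one, Matrix.mul_one]
      _ = P.val * diagonal ![α, β] * (P⁻¹).val := by rw [← Matrix.mul_assoc, ht]
  unfold finCharpolyTwo
  rw [hconj, Matrix.coe_units_inv, Matrix.charpoly_units_conj, Matrix.charpoly_diagonal, Fin.prod_univ_two]
  simp

/-- `χ_{t.1}(γ) = (γ − α)(γ − β)`. [cite: Rogawski1990, §4.9 p. 55] -/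
theorem eval_finCharpolyTwo_eq_of_frame {t : ((cmDatum L 2 (Matrix.of fun i j : Fin 2 => if i.val + j.val + 1 = 2 then (1 : L) else 0)).Local v ×
      (cmDatum L 1 (Matrix.of fun i j : Fin 1 => if i.val + j.val + 1 = 1 then (1 : L) else 0)).Local v)} (P : GL (Fin 2) (LocalRing L v)) {α β : LocalRing L v}
    (ht : (t.1.val.val : Matrix (Fin 2) (Fin 2) (LocalRing L v)) * P.val = P.val * diagonal ![α, β]) :
    (finCharpolyTwo L v t).eval (finGammaTwo L v t) = (finGammaTwo L v t - α) * (finGammaTwo L v t - β) := by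
  rw [finCharpolyTwo_eq_of_frame P ht, eval_mul, eval_sub, eval_sub, eval_X, eval_C, eval_C]

/-- `(γ₂γ₁⁻¹ − 1)(1 − γ₂γ₃⁻¹) = (α − γ)·((γ − β)·det t.1⁻¹)` in the frame. [cite: Rogawski1990, §4.9 p. 55] -/
theorem finTauArg_eq_of_frame {t : ((cmDatum L 2 (Matrix.of fun i j : Fin 2 => if i.val + j.val + 1 = 2 then (1 : L) else 0)).Local v ×
      (cmDatum L 1 (Matrix.of fun i j : Fin 1 => if i.val + j.val + 1 = 1 then (1 : L) else 0)).Local v)} (P : GL (Fin 2) (LocalRing L v)) {α β : LocalRing L v}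
    (ht : (t.1.val.val : Matrix (Fin 2) (Fin 2) (LocalRing L v)) * P.val = P.val * diagonal ![α, β]) :
    finTauArg L v t = (α - finGammaTwo L v t) * ((finGammaTwo L v t - β) * ((t.1.val⁻¹).val : Matrix (Fin 2) (Fin 2) (LocalRing L v)).det) := by
  unfold finTauArg; rw [eval_finCharpolyTwo_eq_of_frame P ht]; ring

/-- **`τ_v(t) = μ(γ)·μ(α − γ)⁻¹·μ((γ − β)·det t.1⁻¹)⁻¹`** in the frame (both arguments units). [cite: Rogawski1990, §4.9 p. 55] -/
theorem finTau_eq_of_frame (μ : HeckeCharacter L) {t : ((cmDatum L 2 (Matrix.of fun i j : Fin 2 => if i.val + j.val + 1 = 2 then (1 : L) else 0)).Local v ×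
      (cmDatum L 1 (Matrix.of fun i j : Fin 1 => if i.val + j.val + 1 = 1 then (1 : L) else 0)).Local v)} (P : GL (Fin 2) (LocalRing L v)) {α β : LocalRing L v}
    (ht : (t.1.val.val : Matrix (Fin 2) (Fin 2) (LocalRing L v)) * P.val = P.val * diagonal ![α, β]) (hαγ : IsUnit (α - finGammaTwo L v t))
    (hq : IsUnit ((finGammaTwo L v t - β) * ((t.1.val⁻¹).val : Matrix (Fin 2) (Fin 2) (LocalRing L v)).det)) :
    finTau L v t μ = finHeckeValue L v μ (finGammaTwo L v t) *
      ((finHeckeValue L v μ (α - finGammaTwo L v t))⁻¹ * (finHeckeValue L v μ ((finGammaTwo L v t - β) * ((t.1.val⁻¹).val : Matrix (Fin 2) (Fin 2) (LocalRing L v)).det))⁻¹) := by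
  unfold finTau; rw [finTauArg_eq_of_frame P ht, finHeckeValue_mul L v μ hαγ hq, mul_inv]

/-- **`D_{G∕H,v}(t) = √Π‖α − γ‖ · √Π‖γ − β‖`** in the frame. [cite: Rogawski1990, §4.9 p. 55] -/
theorem finWeylRatio_eq_of_frame {t : ((cmDatum L 2 (Matrix.of fun i j : Fin 2 => if i.val + j.val + 1 = 2 then (1 : L) else 0)).Local v ×
      (cmDatum L 1 (Matrix.of fun i j : Fin 1 => if i.val + j.val + 1 = 1 then (1 : L) else 0)).Local v)} (P : GL (Fin 2) (LocalRing L v)) {α β : LocalRing L v}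
    (ht : (t.1.val.val : Matrix (Fin 2) (Fin 2) (LocalRing L v)) * P.val = P.val * diagonal ![α, β]) :
    finWeylRatio L v t = Real.sqrt (∏ w' : PlacesOver L v, ‖(α - finGammaTwo L v t) w'‖) *
      Real.sqrt (∏ w' : PlacesOver L v, ‖(finGammaTwo L v t - β) w'‖) := by
  unfold finWeylRatio
  rw [eval_finCharpolyTwo_eq_of_frame P ht, ← Real.sqrt_mul (Finset.prod_nonneg fun _ _ => norm_nonneg _), ← Finset.prod_mul_distrib]
  congr 1; refine Finset.prod_congr rfl fun w' _ => ?_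
  rw [Pi.mul_apply, norm_mul, Pi.sub_apply, Pi.sub_apply, Pi.sub_apply, norm_sub_rev (finGammaTwo L v t w') (α w')]

end Dock

/-! ## §4 HEAD — the binder `hfac` of ★ `exists_nhds_finsum_delta_dock_eq_locallyConstant_of_torusTransfer` -/

section Head

variable (L : Type) [Field L] [NumberField L] [IsCMField L] (H' : Matrix (Fin 3) (Fin 3) L) (v : HeightOneSpectrum (𝓞 ↥(maximalRealSubfield L)))

set_option maxHeartbeats 400000 in
open scoped Classical in
/-- **THE EXPLICIT-FAC↥(Subgroup.centralizer ({εH} : Set ((cmDatum L 2 (Matrix.of fun i j : Fin 2 => if i.val + j.val + 1 = 2 then (1 : L) else 0)).Local v ×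
      (cmDatum L 1 (Matrix.of fun i j : Fin 1 => if i.val + j.val + 1 = 1 then (1 : L) else 0)).Local v))) SPLIT ALONG THE DOCKED ↥(Subgroup.centralizer ({εH} : Set ((cmDatum L 2 (Matrix.of fun i j : Fin 2 => if i.val + j.val + 1 = 2 then (1 : L) else 0)).Local v ×
      (cmDatum L 1 (Matrix.of fun i j : Fin 1 => if i.val + j.val + 1 = 1 then (1 : L) else 0)).Local v)))US** (binder `hfac` of ★ `exists_nhds_finsum_delta_dock_eq_locallyConstant_of_torusTransfer`, with the dress's
weight `fac := μ_w(γ₁ − γ₃)⁻¹·D_H` of ★ `RankOneUnstableTransferNonsplit` in the eigenframe `P` of `t₀ := ε_H`).  Non-split `v`; `ε_H = (A, a)` with eigenframe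
`A·P = P·diag(dg)`, `dg 0 = a ≠ dg 1`; the torus `C = Z_H(ε_H)` diagonalised by `P` (`ht1`); the transport `τ t = (P·diag(α_t, γ_t)·P⁻¹, β_t)` (`hτ1`, `hτ2`: ★
`exists_torusTransport_frame`); a dock `θ` with `θ z = y·ι_v(z)·y⁻¹` on first components (`hθ`: ★ `exists_centralDock_of_fst_eq_smul_one`); the base point `b₀ = ε_H`.
CONCLUSION: near `b₀` there is a CONSTANT `E` with `Δ‴_v(↑t, θ(out ⟦τ t⟧)) = E · μ_w(α_t − γ_t)⁻¹ · √Π_w‖α_t − γ_t‖_w` at every `G`-regular `t` — because on the matched pair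
`Δ‴_v = τ_v·D·κ_v` (★), `τ_v(↑t)·D(↑t) = [μ(γ_t)·μ((γ_t − β_t)·det t.1⁻¹)⁻¹·√Π‖γ_t − β_t‖] · [μ(α_t − γ_t)⁻¹·√Π‖α_t − γ_t‖]` (§3) with the bracket eventually
constant at `b₀` (`γ − β → a − b ≠ 0`: ★ `finHeckeValue_eventually_eq`, ultrametric shells), and `κ_v(↑t, θ(τ t))` is read on the fixed vector `y·(P e₂ ⊕ 0)` (§2).
[cite: Rogawski1990, §4.9 p. 55; §8.2 Prop. 8.2.1 (c) pp. 113–115; §4.3 (4.3.2) p. 43] [cite: LanglandsShelstad1987, §1] [cite: LabesseLanglands1979, §2] -/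
theorem exists_nhds_finExplicitCollection_Δ_dock_eq_mul_rankOneWeight (w : PlacesOver L v) (hw : IsCMField.complexConj L • w.1 = w.1)
    (μ : HeckeCharacter L)
    (hl : ∀ (v : HeightOneSpectrum (𝓞 ↥(maximalRealSubfield L))) (a : ((cmDatum L 2 (Matrix.of fun i j : Fin 2 => if i.val + j.val + 1 = 2 then (1 : L) else 0)).Local v ×
      (cmDatum L 1 (Matrix.of fun i j : Fin 1 => if i.val + j.val + 1 = 1 then (1 : L) else 0)).Local v)) (b : (cmDatum L 3 H').Local v) (x : ((cmDatum L 2 (Matrix.of fun i j : Fin 2 => if i.val + j.val + 1 = 2 then (1 : L) else 0)).Local v ×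
      (cmDatum L 1 (Matrix.of fun i j : Fin 1 => if i.val + j.val + 1 = 1 then (1 : L) else 0)).Local v)),
      finExplicitDelta L v H' (x * a * x⁻¹) μ b = finExplicitDelta L v H' a μ b)
    (hr : ∀ (v : HeightOneSpectrum (𝓞 ↥(maximalRealSubfield L))) (a : ((cmDatum L 2 (Matrix.of fun i j : Fin 2 => if i.val + j.val + 1 = 2 then (1 : L) else 0)).Local v ×
      (cmDatum L 1 (Matrix.of fun i j : Fin 1 => if i.val + j.val + 1 = 1 then (1 : L) else 0)).Local v)) (b y : (cmDatum L 3 H').Local v),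
      finExplicitDelta L v H' a μ (y * b * y⁻¹) = finExplicitDelta L v H' a μ b)
    (εH : ((cmDatum L 2 (Matrix.of fun i j : Fin 2 => if i.val + j.val + 1 = 2 then (1 : L) else 0)).Local v ×
      (cmDatum L 1 (Matrix.of fun i j : Fin 1 => if i.val + j.val + 1 = 1 then (1 : L) else 0)).Local v)) (P : GL (Fin 2) (LocalRing L v)) (dg : Fin 2 → LocalRing L v)
    (hP : (εH.1.val.val : Matrix (Fin 2) (Fin 2) (LocalRing L v)) * P.val = P.val * diagonal dg) (hdg0 : dg 0 = finGammaTwo L v εH) (hdg01 : dg 0 ≠ dg 1)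
    (ht1 : ∀ t : ↥(Subgroup.centralizer ({εH} : Set ((cmDatum L 2 (Matrix.of fun i j : Fin 2 => if i.val + j.val + 1 = 2 then (1 : L) else 0)).Local v ×
      (cmDatum L 1 (Matrix.of fun i j : Fin 1 => if i.val + j.val + 1 = 1 then (1 : L) else 0)).Local v))),
      (t.1.1.val.val : Matrix (Fin 2) (Fin 2) (LocalRing L v)) * P.val = P.val * diagonal ![(P⁻¹.val * t.1.1.val.val * P.val) 0 0, (P⁻¹.val * t.1.1.val.val * P.val) 1 1])
    (τ : ↥(Subgroup.centralizer ({εH} : Set ((cmDatum L 2 (Matrix.of fun i j : Fin 2 => if i.val + j.val + 1 = 2 then (1 : L) else 0)).Local v ×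
      (cmDatum L 1 (Matrix.of fun i j : Fin 1 => if i.val + j.val + 1 = 1 then (1 : L) else 0)).Local v))) → ((cmDatum L 2 (Matrix.of fun i j : Fin 2 => if i.val + j.val + 1 = 2 then (1 : L) else 0)).Local v ×
      (cmDatum L 1 (Matrix.of fun i j : Fin 1 => if i.val + j.val + 1 = 1 then (1 : L) else 0)).Local v))
    (hτ1 : ∀ t : ↥(Subgroup.centralizer ({εH} : Set ((cmDatum L 2 (Matrix.of fun i j : Fin 2 => if i.val + j.val + 1 = 2 then (1 : L) else 0)).Local v ×
      (cmDatum L 1 (Matrix.of fun i j : Fin 1 => if i.val + j.val + 1 = 1 then (1 : L) else 0)).Local v))),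
      ((τ t).1.val.val : Matrix (Fin 2) (Fin 2) (LocalRing L v)) * P.val = P.val * diagonal ![(P⁻¹.val * t.1.1.val.val * P.val) 0 0, finGammaTwo L v t.1])
    (hτ2 : ∀ t : ↥(Subgroup.centralizer ({εH} : Set ((cmDatum L 2 (Matrix.of fun i j : Fin 2 => if i.val + j.val + 1 = 2 then (1 : L) else 0)).Local v ×
      (cmDatum L 1 (Matrix.of fun i j : Fin 1 => if i.val + j.val + 1 = 1 then (1 : L) else 0)).Local v))), ((τ t).2.val.val : Matrix (Fin 1) (Fin 1) (LocalRing L v)) = ((P⁻¹.val * t.1.1.val.val * P.val) 1 1) • (1 : Matrix (Fin 1) (Fin 1) (LocalRing L v)))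
    {ε : (cmDatum L 3 H').Local v} (y : GL (Fin 3) (LocalRing L v)) (θ : ((cmDatum L 2 (Matrix.of fun i j : Fin 2 => if i.val + j.val + 1 = 2 then (1 : L) else 0)).Local v ×
      (cmDatum L 1 (Matrix.of fun i j : Fin 1 => if i.val + j.val + 1 = 1 then (1 : L) else 0)).Local v) ≃ₜ* ↥(Subgroup.centralizer ({ε} : Set ((cmDatum L 3 H').Local v))))
    (hθ : ∀ z : ((cmDatum L 2 (Matrix.of fun i j : Fin 2 => if i.val + j.val + 1 = 2 then (1 : L) else 0)).Local v ×
      (cmDatum L 1 (Matrix.of fun i j : Fin 1 => if i.val + j.val + 1 = 1 then (1 : L) else 0)).Local v), (((θ z).1).val : GL (Fin 3) (LocalRing L v)) = y * ((endoEmbLocal L v z).val : GL (Fin 3) (LocalRing L v)) * y⁻¹)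
    (b₀ : ↥(Subgroup.centralizer ({εH} : Set ((cmDatum L 2 (Matrix.of fun i j : Fin 2 => if i.val + j.val + 1 = 2 then (1 : L) else 0)).Local v ×
      (cmDatum L 1 (Matrix.of fun i j : Fin 1 => if i.val + j.val + 1 = 1 then (1 : L) else 0)).Local v)))) (hb₀ : (b₀ : ((cmDatum L 2 (Matrix.of fun i j : Fin 2 => if i.val + j.val + 1 = 2 then (1 : L) else 0)).Local v ×
      (cmDatum L 1 (Matrix.of fun i j : Fin 1 => if i.val + j.val + 1 = 1 then (1 : L) else 0)).Local v)) = εH) :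
    ∃ V₂ ∈ 𝓝 b₀, ∃ E : ↥(Subgroup.centralizer ({εH} : Set ((cmDatum L 2 (Matrix.of fun i j : Fin 2 => if i.val + j.val + 1 = 2 then (1 : L) else 0)).Local v ×
      (cmDatum L 1 (Matrix.of fun i j : Fin 1 => if i.val + j.val + 1 = 1 then (1 : L) else 0)).Local v))) → ℂ, IsLocallyConstant E ∧ ∀ t ∈ V₂, IsLocalGRegular L v (t : ((cmDatum L 2 (Matrix.of fun i j : Fin 2 => if i.val + j.val + 1 = 2 then (1 : L) else 0)).Local v ×
      (cmDatum L 1 (Matrix.of fun i j : Fin 1 => if i.val + j.val + 1 = 1 then (1 : L) else 0)).Local v)) →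
      ((finExplicitCollection L H' μ hl hr) v).Δ (t : ((cmDatum L 2 (Matrix.of fun i j : Fin 2 => if i.val + j.val + 1 = 2 then (1 : L) else 0)).Local v ×
      (cmDatum L 1 (Matrix.of fun i j : Fin 1 => if i.val + j.val + 1 = 1 then (1 : L) else 0)).Local v)) ((θ (Quotient.out (ConjClasses.mk (τ t))) : ↥(Subgroup.centralizer ({ε} : Set ((cmDatum L 3 H').Local v)))) : (cmDatum L 3 H').Local v) =
        E t * (((finHeckeValue L v μ
            (((P⁻¹).val * ((τ t).1.val.val : Matrix (Fin 2) (Fin 2) (LocalRing L v)) * P.val) 0 0 - ((P⁻¹).val * ((τ t).1.val.val : Matrix (Fin 2) (Fin 2) (LocalRing L v)) * P.val) 1 1))⁻¹ : ℂ) *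
          ((Real.sqrt (∏ w' : PlacesOver L v,
              ‖(((P⁻¹).val * ((τ t).1.val.val : Matrix (Fin 2) (Fin 2) (LocalRing L v)) * P.val) 0 0 - ((P⁻¹).val * ((τ t).1.val.val : Matrix (Fin 2) (Fin 2) (LocalRing L v)) * P.val) 1 1) w'‖) : ℝ) : ℂ)) := by
  classical
  haveI hv : Subsingleton (PlacesOver L v) :=
    PlacesOver.subsingleton_of_smul_eq (IsCMField.complexConj L) (IsCMField.complexConj_ne_one L) w hw
  -- the base values `γ(b₀) = dg 0`, `β(b₀) = dg 1`
  have hPd : (P⁻¹).val * (εH.1.val.val : Matrix (Fin 2) (Fin 2) (LocalRing L v)) * P.val = diagonal dg := by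
    rw [Matrix.mul_assoc, hP, ← Matrix.mul_assoc, ← Units.val_mul, inv_mul_cancel, Units.val_one, Matrix.one_mul]
  have hγ0 : finGammaTwo L v b₀.1 = dg 0 := by rw [hb₀]; exact hdg0.symm
  have hβ0 : ((P⁻¹).val * (b₀.1.1.val.val : Matrix (Fin 2) (Fin 2) (LocalRing L v)) * P.val) 1 1 = dg 1 := by rw [hb₀, hPd]; simp
  have hne0 : finGammaTwo L v b₀.1 - ((P⁻¹).val * (b₀.1.1.val.val : Matrix (Fin 2) (Fin 2) (LocalRing L v)) * P.val) 1 1 ≠ 0 := by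
    rw [hγ0, hβ0]; exact sub_ne_zero.2 hdg01
  have hu0 : IsUnit (finGammaTwo L v b₀.1 - ((P⁻¹).val * (b₀.1.1.val.val : Matrix (Fin 2) (Fin 2) (LocalRing L v)) * P.val) 1 1) :=
    isUnit_localRing_of_ne_zero_of_subsingleton L v hv hne0
  have huq0 : IsUnit ((finGammaTwo L v b₀.1 - ((P⁻¹).val * (b₀.1.1.val.val : Matrix (Fin 2) (Fin 2) (LocalRing L v)) * P.val) 1 1) * ((b₀.1.1.val⁻¹).val : Matrix (Fin 2) (Fin 2) (LocalRing L v)).det) :=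
    hu0.mul (Matrix.isUnits_det_units _)
  -- continuity along the torus
  have hcM : Continuous fun t : ↥(Subgroup.centralizer ({εH} : Set ((cmDatum L 2 (Matrix.of fun i j : Fin 2 => if i.val + j.val + 1 = 2 then (1 : L) else 0)).Local v ×
      (cmDatum L 1 (Matrix.of fun i j : Fin 1 => if i.val + j.val + 1 = 1 then (1 : L) else 0)).Local v))) => (P⁻¹).val * (t.1.1.val.val : Matrix (Fin 2) (Fin 2) (LocalRing L v)) * P.val :=
    (continuous_const.matrix_mul ((continuous_fst_localMatrix L v).comp continuous_subtype_val)).matrix_mul continuous_const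
  have hcβ : Continuous fun t : ↥(Subgroup.centralizer ({εH} : Set ((cmDatum L 2 (Matrix.of fun i j : Fin 2 => if i.val + j.val + 1 = 2 then (1 : L) else 0)).Local v ×
      (cmDatum L 1 (Matrix.of fun i j : Fin 1 => if i.val + j.val + 1 = 1 then (1 : L) else 0)).Local v))) => ((P⁻¹).val * (t.1.1.val.val : Matrix (Fin 2) (Fin 2) (LocalRing L v)) * P.val) 1 1 := hcM.matrix_elem 1 1
  have hcγ : Continuous fun t : ↥(Subgroup.centralizer ({εH} : Set ((cmDatum L 2 (Matrix.of fun i j : Fin 2 => if i.val + j.val + 1 = 2 then (1 : L) else 0)).Local v ×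
      (cmDatum L 1 (Matrix.of fun i j : Fin 1 => if i.val + j.val + 1 = 1 then (1 : L) else 0)).Local v))) => finGammaTwo L v t.1 := (continuous_finGammaTwo L v).comp continuous_subtype_val
  have hcD : Continuous fun t : ↥(Subgroup.centralizer ({εH} : Set ((cmDatum L 2 (Matrix.of fun i j : Fin 2 => if i.val + j.val + 1 = 2 then (1 : L) else 0)).Local v ×
      (cmDatum L 1 (Matrix.of fun i j : Fin 1 => if i.val + j.val + 1 = 1 then (1 : L) else 0)).Local v))) => ((t.1.1.val⁻¹).val : Matrix (Fin 2) (Fin 2) (LocalRing L v)).det :=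
    (Units.continuous_coe_inv.comp (continuous_subtype_val.comp (continuous_fst.comp continuous_subtype_val))).matrix_det
  have hcq : Continuous fun t : ↥(Subgroup.centralizer ({εH} : Set ((cmDatum L 2 (Matrix.of fun i j : Fin 2 => if i.val + j.val + 1 = 2 then (1 : L) else 0)).Local v ×
      (cmDatum L 1 (Matrix.of fun i j : Fin 1 => if i.val + j.val + 1 = 1 then (1 : L) else 0)).Local v))) =>
      (finGammaTwo L v t.1 - ((P⁻¹).val * (t.1.1.val.val : Matrix (Fin 2) (Fin 2) (LocalRing L v)) * P.val) 1 1) * ((t.1.1.val⁻¹).val : Matrix (Fin 2) (Fin 2) (LocalRing L v)).det :=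
    (hcγ.sub hcβ).mul hcD
  -- the three eventualities at `b₀`
  have e1 : ∀ᶠ t : ↥(Subgroup.centralizer ({εH} : Set ((cmDatum L 2 (Matrix.of fun i j : Fin 2 => if i.val + j.val + 1 = 2 then (1 : L) else 0)).Local v ×
      (cmDatum L 1 (Matrix.of fun i j : Fin 1 => if i.val + j.val + 1 = 1 then (1 : L) else 0)).Local v))) in 𝓝 b₀, finHeckeValue L v μ (finGammaTwo L v t.1) = finHeckeValue L v μ (finGammaTwo L v b₀.1) :=
    (hcγ.tendsto b₀).eventually (finHeckeValue_eventually_eq L v μ (isUnit_finGammaTwo L v b₀.1))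
  have e2 : ∀ᶠ t : ↥(Subgroup.centralizer ({εH} : Set ((cmDatum L 2 (Matrix.of fun i j : Fin 2 => if i.val + j.val + 1 = 2 then (1 : L) else 0)).Local v ×
      (cmDatum L 1 (Matrix.of fun i j : Fin 1 => if i.val + j.val + 1 = 1 then (1 : L) else 0)).Local v))) in 𝓝 b₀,
      finHeckeValue L v μ ((finGammaTwo L v t.1 - ((P⁻¹).val * (t.1.1.val.val : Matrix (Fin 2) (Fin 2) (LocalRing L v)) * P.val) 1 1) * ((t.1.1.val⁻¹).val : Matrix (Fin 2) (Fin 2) (LocalRing L v)).det) =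
        finHeckeValue L v μ ((finGammaTwo L v b₀.1 - ((P⁻¹).val * (b₀.1.1.val.val : Matrix (Fin 2) (Fin 2) (LocalRing L v)) * P.val) 1 1) * ((b₀.1.1.val⁻¹).val : Matrix (Fin 2) (Fin 2) (LocalRing L v)).det) :=
    (hcq.tendsto b₀).eventually (finHeckeValue_eventually_eq L v μ huq0)
  have e3 : ∀ᶠ t : ↥(Subgroup.centralizer ({εH} : Set ((cmDatum L 2 (Matrix.of fun i j : Fin 2 => if i.val + j.val + 1 = 2 then (1 : L) else 0)).Local v ×
      (cmDatum L 1 (Matrix.of fun i j : Fin 1 => if i.val + j.val + 1 = 1 then (1 : L) else 0)).Local v))) in 𝓝 b₀,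
      ∏ w' : PlacesOver L v, ‖(finGammaTwo L v t.1 - ((P⁻¹).val * (t.1.1.val.val : Matrix (Fin 2) (Fin 2) (LocalRing L v)) * P.val) 1 1) w'‖ =
        ∏ w' : PlacesOver L v, ‖(finGammaTwo L v b₀.1 - ((P⁻¹).val * (b₀.1.1.val.val : Matrix (Fin 2) (Fin 2) (LocalRing L v)) * P.val) 1 1) w'‖ := by
    have hw' : ∀ w' : PlacesOver L v, ∀ᶠ t : ↥(Subgroup.centralizer ({εH} : Set ((cmDatum L 2 (Matrix.of fun i j : Fin 2 => if i.val + j.val + 1 = 2 then (1 : L) else 0)).Local v ×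
      (cmDatum L 1 (Matrix.of fun i j : Fin 1 => if i.val + j.val + 1 = 1 then (1 : L) else 0)).Local v))) in 𝓝 b₀,
        ‖(finGammaTwo L v t.1 - ((P⁻¹).val * (t.1.1.val.val : Matrix (Fin 2) (Fin 2) (LocalRing L v)) * P.val) 1 1) w'‖ =
          ‖(finGammaTwo L v b₀.1 - ((P⁻¹).val * (b₀.1.1.val.val : Matrix (Fin 2) (Fin 2) (LocalRing L v)) * P.val) 1 1) w'‖ := fun w' =>
      (((continuous_apply w').comp (hcγ.sub hcβ)).tendsto b₀).eventually
        (norm_eventually_eq_of_ne_zero'' w'.1 (((Pi.isUnit_iff.1 hu0) w').ne_zero))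
    filter_upwards [eventually_all.2 hw'] with t ht using Finset.prod_congr rfl fun w' _ => ht w'
  obtain ⟨V₂, hV₂, hV⟩ := (e1.and (e2.and e3)).exists_mem
  refine ⟨V₂, hV₂, fun _ =>
    finHeckeValue L v μ (finGammaTwo L v b₀.1) *
      (finHeckeValue L v μ ((finGammaTwo L v b₀.1 - ((P⁻¹).val * (b₀.1.1.val.val : Matrix (Fin 2) (Fin 2) (LocalRing L v)) * P.val) 1 1) * ((b₀.1.1.val⁻¹).val : Matrix (Fin 2) (Fin 2) (LocalRing L v)).det))⁻¹ *
      ((Real.sqrt (∏ w' : PlacesOver L v, ‖(finGammaTwo L v b₀.1 - ((P⁻¹).val * (b₀.1.1.val.val : Matrix (Fin 2) (Fin 2) (LocalRing L v)) * P.val) 1 1) w'‖) : ℝ) : ℂ) *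
      (((if ∃ z : LocalRing L v, IsUnit z ∧
          (∑ i : Fin 3, ∑ k : Fin 3, conjLocal L (IsCMField.complexConj L) v ((y.val *ᵥ ![P.val 0 1, 0, P.val 1 1]) i) *
            ((adelicForm L 3 H').map (adeleToLocal L v)) i k * (y.val *ᵥ ![P.val 0 1, 0, P.val 1 1]) k) =
          z * conjLocal L (IsCMField.complexConj L) v z then 1 else -1 : ℤ)) : ℂ),
    IsLocallyConstant.const _, fun t ht hreg => ?_⟩
  obtain ⟨h1, h2, h3⟩ := hV t ht
  -- `Δ‴_v(↑t, ·)` is a class function: reduce `θ(out ⟦τ t⟧)` to `θ(τ t)`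
  obtain ⟨x, hx⟩ := isConj_iff.1 (ConjClasses.mk_eq_mk_iff_isConj.1 (Quotient.out_eq (ConjClasses.mk (τ t))).symm)
  rw [← hx, map_mul, map_mul, map_inv, Subgroup.coe_mul, Subgroup.coe_mul, Subgroup.coe_inv]
  show finExplicitDelta L v H' (t : ((cmDatum L 2 (Matrix.of fun i j : Fin 2 => if i.val + j.val + 1 = 2 then (1 : L) else 0)).Local v ×
      (cmDatum L 1 (Matrix.of fun i j : Fin 1 => if i.val + j.val + 1 = 1 then (1 : L) else 0)).Local v)) μ _ = _
  rw [hr]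
  -- the matched pair `(↑t, θ(τ t))` and its factors
  have hb : ((((θ (τ t) : ↥(Subgroup.centralizer ({ε} : Set ((cmDatum L 3 H').Local v)))) : (cmDatum L 3 H').Local v)).val : GL (Fin 3) (LocalRing L v)) =
      y * ((endoEmbLocal L v (τ t)).val : GL (Fin 3) (LocalRing L v)) * y⁻¹ := hθ (τ t)
  have hmatch : IsLocalNormPair L H' v (t : ((cmDatum L 2 (Matrix.of fun i j : Fin 2 => if i.val + j.val + 1 = 2 then (1 : L) else 0)).Local v ×
      (cmDatum L 1 (Matrix.of fun i j : Fin 1 => if i.val + j.val + 1 = 1 then (1 : L) else 0)).Local v)) ((θ (τ t) : ↥(Subgroup.centralizer ({ε} : Set ((cmDatum L 3 H').Local v)))) : (cmDatum L 3 H').Local v) :=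
    isLocalNormPair_of_frames_of_val_eq_conj P (ht1 t) (hτ1 t) (hτ2 t) hb
  have hu : IsUnit ((finCharpolyTwo L v (t : ((cmDatum L 2 (Matrix.of fun i j : Fin 2 => if i.val + j.val + 1 = 2 then (1 : L) else 0)).Local v ×
      (cmDatum L 1 (Matrix.of fun i j : Fin 1 => if i.val + j.val + 1 = 1 then (1 : L) else 0)).Local v))).eval (finGammaTwo L v (t : ((cmDatum L 2 (Matrix.of fun i j : Fin 2 => if i.val + j.val + 1 = 2 then (1 : L) else 0)).Local v ×
      (cmDatum L 1 (Matrix.of fun i j : Fin 1 => if i.val + j.val + 1 = 1 then (1 : L) else 0)).Local v)))) :=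
    isUnit_eval_finCharpolyTwo_of_isLocalGRegular L v _ hreg
  have hκ := finKappaAt_eq_ite_of_frames_of_val_eq_conj (H' := H') hv P (ht1 t) (hτ1 t) (hτ2 t) hb hu
  have hu' := hu; rw [eval_finCharpolyTwo_eq_of_frame P (ht1 t)] at hu'
  have hαγ : IsUnit ((P⁻¹.val * (t.1.1.val.val : Matrix (Fin 2) (Fin 2) (LocalRing L v)) * P.val) 0 0 - finGammaTwo L v t.1) := by
    rw [← neg_sub]; exact (isUnit_of_mul_isUnit_left hu').neg
  have hq : IsUnit ((finGammaTwo L v t.1 - (P⁻¹.val * (t.1.1.val.val : Matrix (Fin 2) (Fin 2) (LocalRing L v)) * P.val) 1 1) * ((t.1.1.val⁻¹).val : Matrix (Fin 2) (Fin 2) (LocalRing L v)).det) :=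
    (isUnit_of_mul_isUnit_right hu').mul (Matrix.isUnits_det_units _)
  -- the frame entries of `τ t`: `γ₁(τ t) = α_t`, `γ₃(τ t) = γ_t`
  have hτd : (P⁻¹).val * ((τ t).1.val.val : Matrix (Fin 2) (Fin 2) (LocalRing L v)) * P.val = diagonal ![(P⁻¹.val * (t.1.1.val.val : Matrix (Fin 2) (Fin 2) (LocalRing L v)) * P.val) 0 0, finGammaTwo L v t.1] := by
    rw [Matrix.mul_assoc, hτ1 t, ← Matrix.mul_assoc, ← Units.val_mul, inv_mul_cancel, Units.val_one, Matrix.one_mul]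
  have e00 : ((P⁻¹).val * ((τ t).1.val.val : Matrix (Fin 2) (Fin 2) (LocalRing L v)) * P.val) 0 0 = (P⁻¹.val * (t.1.1.val.val : Matrix (Fin 2) (Fin 2) (LocalRing L v)) * P.val) 0 0 := by rw [hτd]; simp
  have e11 : ((P⁻¹).val * ((τ t).1.val.val : Matrix (Fin 2) (Fin 2) (LocalRing L v)) * P.val) 1 1 = finGammaTwo L v t.1 := by rw [hτd]; simp
  rw [e00, e11, finExplicitDelta_of_isLocalNormPair L v H' _ μ hmatch, hκ, finTau_eq_of_frame μ P (ht1 t) hαγ hq,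
    finWeylRatio_eq_of_frame P (ht1 t), h1, h2, h3]
  push_cast; ring

end Head



end Literature.NumberTheory.Rogawski1990

end
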